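import Mathlib
import HarnessLib
import Summits.ResolutionOfSingularities.ResolutionOfSingularities.Theorems.WildQuotientsWildQuotientResolutionS1aD4Move3
import Summits.ResolutionOfSingularities.ResolutionOfSingularities.Theorems.WildQuotientsWildQuotientResolutionS1aD4KillLeaf1
import Summits.ResolutionOfSingularities.ResolutionOfSingularities.Theorems.WildQuotientsWildQuotientResolutionS1aD4ZChartModel
import Summits.ResolutionOfSingularities.ResolutionOfSingularities.Theorems.WildQuotientsWildQuotientResolutionS1aD4Move2Cover

/-!
# S1a — INSTANCE I-3 (D₄): the second leaf level — from the exposed node of `[z′]` (output of `d4_move2`) to `KillsIn 2`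

[OURS · L1 W4.5c · lead-1 g13; plan-1 RULING R-F15e (I-3 = `KillsIn 4 (initial)` on MT-D₄ v1.1, leaves upward `d4_killsIn_one/two/…`), X-CERT v1.2-D4ROWS moves 3–4,
NOTES `D4 TREE OF RECORD`] — NOT statements of the manuscript; counted 0; AI-level work, weaker than expert review. Crux stmt-ResolutionOfSingularities-17941
`CyclicQuotientFourfolds`, line `s1a-logminvertex` v13 (`stub_reachLowerInFX`).
★★★ `GameFrame.GModel.d4_killsIn_two` — `M₂` carrying the output of ✓`d4_move2` over the free model `P = k[s, X₀, X₁, z, x₃][1/h₁]` of the (re-coordinated) node of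
`N(x₁)`: the residual chart `W₂ = [z′]` with its pinned node, the ratio section, pulled-back sections with values in `(X₀)`, an atlas with `F ⊆ W₂`, and
separatedness of all models ⇒ `KillsIn 2 M₂`: the sheared free model of `Γ(W₂)` (✓`exists_d4ZChartModel`), ✓`d4_move3` (move 3: `N(w)` killed, node of `[Y]₂`
exposed) and ✓`d4_killsIn_one` on every realisation.
-/

set_option linter.dupNamespace false

noncomputable section

open CategoryTheory Limits AlgebraicGeometry TopologicalSpace Topology Opposite
open Literature.AlgebraicGeometry.Resolution Literature.AlgebraicGeometry.RelativeSpec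
open scoped LaurentPolynomial
open MvPolynomial
open Summit.ResolutionOfSingularities.ResolutionOfSingularities.Theorems.WildQuotientResolution.S1 Summit.ResolutionOfSingularities.ResolutionOfSingularities.Theorems.WildQuotientResolution.S1.NodeAtlas Summit.ResolutionOfSingularities.ResolutionOfSingularities.Theorems.WildQuotientResolution.S1.CoarseChart
open Summit.ResolutionOfSingularities.ResolutionOfSingularities.Theorems.WildQuotientResolution.S1.ProducerStep Summit.ResolutionOfSingularities.ResolutionOfSingularities.Theorems.WildQuotientResolution.S1.NpFrame Summit.ResolutionOfSingularities.ResolutionOfSingularities.Theorems.WildQuotientResolution.S1.GoodCharts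
open Summit.ResolutionOfSingularities.ResolutionOfSingularities.Theorems.WildQuotientResolution.S1.BlowupCharts Summit.ResolutionOfSingularities.ResolutionOfSingularities.Theorems.WildQuotientResolution.S1.KillCert Summit.ResolutionOfSingularities.ResolutionOfSingularities.Theorems.WildQuotientResolution.S1.ReesBigrading
open Summit.ResolutionOfSingularities.ResolutionOfSingularities.Theorems.WildQuotientResolution.S1.NodeTransport Summit.ResolutionOfSingularities.ResolutionOfSingularities.Theorems.WildQuotientResolution.S1.CobordantTransport Summit.ResolutionOfSingularities.ResolutionOfSingularities.Theorems.WildQuotientResolution.S1.FreeModel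
open Summit.ResolutionOfSingularities.ResolutionOfSingularities.Theorems.WildQuotientResolution.S1.ModelNode

namespace Summit.ResolutionOfSingularities.ResolutionOfSingularities.Theorems.WildQuotientResolution.S1.GameFrame.GModel

variable {p : ℕ} {X' X₁ : Scheme.{0}} {q : X' ⟶ X₁} {G : Type} [Group G] {ρ : G →* Aut X'} {g₀ : G}

set_option maxHeartbeats 16000000 in
set_option synthInstance.maxHeartbeats 400000 in
/-- ★★★ **From the exposed node of `[z′]` to `KillsIn 2`** (moves 3 and 4 of MT-D₄). See the module docstring.
[OURS · L1 W4.5c · R-F15e I-3; NOT a statement of the manuscript] -/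
theorem d4_killsIn_two [Finite G] [NeZero p] (hp : p.Prime) (hG : ∀ g : G, g ∈ Subgroup.zpowers g₀) {k : Type} [Field k] [CharP k p]
    (hsep : ∀ M : GModel p q G ρ g₀, M.V.IsSeparated) (M₂ : GModel p q G ρ g₀)
    -- the free model `P = k[s, X₀, X₁, z, x₃][1/h₁]` of the node of `N(x₁)`, re-coordinated (`z = x₂ − sX₁` fixed)
    (hh₁ : MvPolynomial (Option (Fin 4)) k) (d : ℕ) (hd : 0 < d) (hhh₁ : hh₁ = (∏ j : ZMod p, (X (some 1) + C (j.val : k) * (X (some 0) * X none))) ^ (2 * d))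
    (s X₀ X₁ z x₃ : Localization.Away hh₁)
    (hs : s = algebraMap (MvPolynomial (Option (Fin 4)) k) (Localization.Away hh₁) (X none)) (hX₀ : X₀ = algebraMap (MvPolynomial (Option (Fin 4)) k) (Localization.Away hh₁) (X (some 0)))
    (hX₁ : X₁ = algebraMap (MvPolynomial (Option (Fin 4)) k) (Localization.Away hh₁) (X (some 1))) (hz : z = algebraMap (MvPolynomial (Option (Fin 4)) k) (Localization.Away hh₁) (X (some 2)))
    (hx₃ : x₃ = algebraMap (MvPolynomial (Option (Fin 4)) k) (Localization.Away hh₁) (X (some 3)))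
    {m : ℕ} {r : Fin m → ℕ} (𝒜P : (Π j : Fin m, ZMod (r j)) → AddSubgroup (Localization.Away hh₁)) [GradedRing 𝒜P] (θ : Π j : Fin m, ZMod (r j))
    (τP : Localization.Away hh₁ ≃+* Localization.Away hh₁)
    (r0 : τP s = s) (r1 : τP X₀ = X₀) (r2 : τP X₁ = X₁ + X₀ * s) (rz : τP z = z) (r4 : τP x₃ = x₃ - s * X₁ * z * (z + s * X₁))
    (r5 : ∀ g' ∈ (({IsLocalization.Away.invSelf hh₁} : Set (Localization.Away hh₁)) ∪ Set.range (algebraMap k (Localization.Away hh₁))), τP g' = g')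
    (rh : τP (algebraMap (MvPolynomial (Option (Fin 4)) k) (Localization.Away hh₁) hh₁) = algebraMap (MvPolynomial (Option (Fin 4)) k) (Localization.Away hh₁) hh₁)
    (hσp₂ : ∀ x : Localization.Away hh₁, (⇑τP)^[p] x = x)
    (dg1 : X₁ ∈ 𝒜P θ) (dgs : s ∈ 𝒜P (-θ)) (dgη : IsLocalization.Away.invSelf hh₁ ∈ 𝒜P (-((d * (2 * p)) • θ)))
    -- the output of move 2 on `M₂`
    (d₂ : ℕ) (hd₂ : 0 < d₂) (W₂ : M₂.act.StableAffineOpens) (hW₂aff : IsAffineOpen W₂.1)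
    (hf₂ : ∀ i, (![z, X₀] : Fin 2 → Localization.Away hh₁) i ∈ 𝒜P ((![0, 2 • θ] : Fin 2 → Π j : Fin m, ZMod (r j)) i))
    (hσJ₂ : ∀ n : ℕ, ((weightedFiltration (![z, X₀] : Fin 2 → Localization.Away hh₁) ![1, 1]).ideal n).map (τP : Localization.Away hh₁ →+* Localization.Away hh₁) ≤
      (weightedFiltration (![z, X₀] : Fin 2 → Localization.Away hh₁) ![1, 1]).ideal n)
    (y₀ : ↥(𝒜P 0)) (hy₀v : (y₀ : Localization.Away hh₁) = z ^ (d₂ * (d * (2 * p))))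
    (hy₀ : y₀ ∈ (traceFiltration 𝒜P (![z, X₀] : Fin 2 → Localization.Away hh₁) ![1, 1]).ideal (d₂ * (d * (2 * p)))) (hσy₀ : τP (y₀ : Localization.Away hh₁) = y₀)
    (c₁ : ↥(cobordantAlgebra (![z, X₀] : Fin 2 → Localization.Away hh₁) ![1, 1]))
    (hc₁ : (c₁ : (Localization.Away hh₁)[T;T⁻¹]) = LaurentPolynomial.C ((X₀ ^ (d * p) * IsLocalization.Away.invSelf hh₁) ^ (2 * d₂)) * LaurentPolynomial.T (((d₂ * (d * (2 * p)) : ℕ)) : ℤ))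
    (E₂ : letI := chartNodeGradedRing r 𝒜P (![z, X₀] : Fin 2 → Localization.Away hh₁) ![1, 1] hf₂ (d₂ * (d * (2 * p))) y₀ hy₀;
      Γ(M₂.V, W₂.1) ≃+* ↥(chartNodeGrading r 𝒜P (![z, X₀] : Fin 2 → Localization.Away hh₁) ![1, 1] hf₂ (d₂ * (d * (2 * p))) y₀ hy₀ 0))
    (htame₂ : letI := chartNodeGradedRing r 𝒜P (![z, X₀] : Fin 2 → Localization.Away hh₁) ![1, 1] hf₂ (d₂ * (d * (2 * p))) y₀ hy₀;
      IsTameNode p (ChartRing 𝒜P (![z, X₀] : Fin 2 → Localization.Away hh₁) ![1, 1] (d₂ * (d * (2 * p))) y₀ hy₀)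
        (chartNodeGrading r 𝒜P (![z, X₀] : Fin 2 → Localization.Away hh₁) ![1, 1] hf₂ (d₂ * (d * (2 * p))) y₀ hy₀)
        (sigmaChart 𝒜P (![z, X₀] : Fin 2 → Localization.Away hh₁) ![1, 1] (d₂ * (d * (2 * p))) y₀ hy₀ τP hσJ₂ hp.pos hσp₂ hσy₀))
    (hE₂ : letI := chartNodeGradedRing r 𝒜P (![z, X₀] : Fin 2 → Localization.Away hh₁) ![1, 1] hf₂ (d₂ * (d * (2 * p))) y₀ hy₀; ∀ t' : Γ(M₂.V, W₂.1),
      ((E₂ ((M₂.act.aut g₀⁻¹).hom.appLE W₂.1 W₂.1 (W₂.2.1 g₀⁻¹).ge t') : ↥(chartNodeGrading r 𝒜P (![z, X₀] : Fin 2 → Localization.Away hh₁) ![1, 1] hf₂ (d₂ * (d * (2 * p))) y₀ hy₀ 0)) :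
          ChartRing 𝒜P (![z, X₀] : Fin 2 → Localization.Away hh₁) ![1, 1] (d₂ * (d * (2 * p))) y₀ hy₀) =
        sigmaChart 𝒜P (![z, X₀] : Fin 2 → Localization.Away hh₁) ![1, 1] (d₂ * (d * (2 * p))) y₀ hy₀ τP hσJ₂ hp.pos hσp₂ hσy₀
          ((E₂ t' : ↥(chartNodeGrading r 𝒜P (![z, X₀] : Fin 2 → Localization.Away hh₁) ![1, 1] hf₂ (d₂ * (d * (2 * p))) y₀ hy₀ 0)) : ChartRing 𝒜P (![z, X₀] : Fin 2 → Localization.Away hh₁) ![1, 1] (d₂ * (d * (2 * p))) y₀ hy₀))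
    {ι : Type} (U : ι → M₂.V.Opens) (W₂' : M₂.V.Opens) (hcov : ∀ x : M₂.V, x ∈ W₂.1 ∨ x ∈ W₂' ∨ ∃ i, x ∈ U i)
    (u₂ : Γ(M₂.V, W₂.1))
    (hu₂v : letI := chartNodeGradedRing r 𝒜P (![z, X₀] : Fin 2 → Localization.Away hh₁) ![1, 1] hf₂ (d₂ * (d * (2 * p))) y₀ hy₀;
      ((E₂ u₂ : ↥(chartNodeGrading r 𝒜P (![z, X₀] : Fin 2 → Localization.Away hh₁) ![1, 1] hf₂ (d₂ * (d * (2 * p))) y₀ hy₀ 0)) : ChartRing 𝒜P (![z, X₀] : Fin 2 → Localization.Away hh₁) ![1, 1] (d₂ * (d * (2 * p))) y₀ hy₀) =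
        algebraMap _ (ChartRing 𝒜P (![z, X₀] : Fin 2 → Localization.Away hh₁) ![1, 1] (d₂ * (d * (2 * p))) y₀ hy₀) c₁ *
          IsLocalization.Away.invSelf (coverElement 𝒜P (![z, X₀] : Fin 2 → Localization.Away hh₁) ![1, 1] (d₂ * (d * (2 * p))) y₀ hy₀))
    (hu₂U : ∀ v ∈ W₂.1, v ∈ W₂' → v ∈ M₂.V.basicOpen u₂)
    (uU : ι → Γ(M₂.V, W₂.1)) (xU : ι → ↥(𝒜P 0)) (hxU : ∀ i, (xU i : Localization.Away hh₁) ∈ Ideal.span {X₀})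
    (huUv : letI := chartNodeGradedRing r 𝒜P (![z, X₀] : Fin 2 → Localization.Away hh₁) ![1, 1] hf₂ (d₂ * (d * (2 * p))) y₀ hy₀; ∀ i,
      ((E₂ (uU i) : ↥(chartNodeGrading r 𝒜P (![z, X₀] : Fin 2 → Localization.Away hh₁) ![1, 1] hf₂ (d₂ * (d * (2 * p))) y₀ hy₀ 0)) : ChartRing 𝒜P (![z, X₀] : Fin 2 → Localization.Away hh₁) ![1, 1] (d₂ * (d * (2 * p))) y₀ hy₀) =
        toChartRing 𝒜P (![z, X₀] : Fin 2 → Localization.Away hh₁) ![1, 1] (d₂ * (d * (2 * p))) y₀ hy₀ (xU i))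
    (huUU : ∀ i, ∀ v ∈ W₂.1, v ∈ U i → v ∈ M₂.V.basicOpen (uU i))
    (𝔄₂ : NodeAtlasData p M₂.act g₀) (hF₂ : 𝔄₂.fLocus ⊆ (W₂.1 : Set M₂.V)) :
    KillsIn 2 M₂ := by
  classical
  haveI := hsep M₂
  letI instN := chartNodeGradedRing r 𝒜P (![z, X₀] : Fin 2 → Localization.Away hh₁) ![1, 1] hf₂ (d₂ * (d * (2 * p))) y₀ hy₀
  have hdp : 0 < d * p := Nat.mul_pos hd hp.pos
  have hd' : 0 < 2 * d * d₂ := Nat.mul_pos (Nat.mul_pos two_pos hd) hd₂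
  -- ### the sheared free model `Q` of `Γ(W₂)` with all its facts
  obtain ⟨hQ, hhQ⟩ : ∃ hQ : MvPolynomial (Option (Option (Fin 4))) k, hQ = (∏ j : ZMod p, (X (some (some 2)) * X (some (some 1)) + C (j.val : k) * ((X none - X (some none) * X (some (some 1))) * X (some (some 0)) * X (some none)))) ^ (2 * d) * X (some (some 2)) ^ (d₂ * (d * (2 * p))) := ⟨_, rfl⟩
  obtain ⟨ΦQ, t, V₀, Vi, NX, rt, rs, rY, rZ, rX₁, rx₃, rw', rV₀, hVV, rN, rfix, rhQ, hgen, hX₁u, hZu, hV₀u, hNu, dY, dw, dδ, dV, ds, dt, dN, hK1, hK1', hchar, hQu1, hQX₀⟩ :=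
    D4.exists_d4ZChartModel hp hh₁ d hd hhh₁ s X₀ X₁ z x₃ hs hX₀ hX₁ hz hx₃ 𝒜P θ τP r0 r1 r2 rz r4 r5 rh hσp₂ dg1 dgs dgη d₂ hd₂ hf₂ hσJ₂ y₀ hy₀v hy₀ hσy₀ hQ hhQ
  haveI := hchar
  letI instM := mapGradedRing (chartNodeGrading r 𝒜P (![z, X₀] : Fin 2 → Localization.Away hh₁) ![1, 1] hf₂ (d₂ * (d * (2 * p))) y₀ hy₀) ΦQ
  -- ### the closedness family on `M₂` through `Φ_Q`: values in `𝒥₁ = (Y, w̃)`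
  have hJY : algebraMap (MvPolynomial (Option (Option (Fin 4))) k) (Localization.Away hQ) (X (some (some 0))) ∈ (weightedFiltration (![algebraMap (MvPolynomial (Option (Option (Fin 4))) k) (Localization.Away hQ) (X (some (some 0))),
      algebraMap (MvPolynomial (Option (Option (Fin 4))) k) (Localization.Away hQ) (X none)] : Fin 2 → Localization.Away hQ) ![2, 1]).ideal 1 :=
    (weightedFiltration _ _).antitone (by norm_num : 1 ≤ 2) (mem_weightedFiltration_ideal (![_, _] : Fin 2 → _) ![2, 1] 0)
  have hu₂val : ΦQ ((E₂ u₂ : ↥(chartNodeGrading r 𝒜P (![z, X₀] : Fin 2 → Localization.Away hh₁) ![1, 1] hf₂ (d₂ * (d * (2 * p))) y₀ hy₀ 0)) : ChartRing 𝒜P (![z, X₀] : Fin 2 → Localization.Away hh₁) ![1, 1] (d₂ * (d * (2 * p))) y₀ hy₀) ∈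
      (weightedFiltration (![algebraMap (MvPolynomial (Option (Option (Fin 4))) k) (Localization.Away hQ) (X (some (some 0))), algebraMap (MvPolynomial (Option (Option (Fin 4))) k) (Localization.Away hQ) (X none)] : Fin 2 → Localization.Away hQ) ![2, 1]).ideal 1 := by
    rw [hu₂v, map_mul, D4.d4m2_coverElement_one_eq z X₀ (IsLocalization.Away.invSelf hh₁) d d₂ c₁ hc₁]
    simp only [map_mul, map_pow]
    rw [hQu1]
    exact Ideal.mul_mem_right _ _ (Ideal.mul_mem_right _ _ (Ideal.pow_mem_of_mem _ hJY _ (Nat.mul_pos hdp (Nat.mul_pos two_pos hd₂))))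
  have huUval : ∀ i, ΦQ ((E₂ (uU i) : ↥(chartNodeGrading r 𝒜P (![z, X₀] : Fin 2 → Localization.Away hh₁) ![1, 1] hf₂ (d₂ * (d * (2 * p))) y₀ hy₀ 0)) : ChartRing 𝒜P (![z, X₀] : Fin 2 → Localization.Away hh₁) ![1, 1] (d₂ * (d * (2 * p))) y₀ hy₀) ∈
      (weightedFiltration (![algebraMap (MvPolynomial (Option (Option (Fin 4))) k) (Localization.Away hQ) (X (some (some 0))), algebraMap (MvPolynomial (Option (Option (Fin 4))) k) (Localization.Away hQ) (X none)] : Fin 2 → Localization.Away hQ) ![2, 1]).ideal 1 := by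
    intro i
    obtain ⟨a, ha⟩ := Ideal.mem_span_singleton'.mp (hxU i)
    rw [huUv]
    change ΦQ (algebraMap ↥(cobordantAlgebra (![z, X₀] : Fin 2 → Localization.Away hh₁) ![1, 1]) (ChartRing 𝒜P (![z, X₀] : Fin 2 → Localization.Away hh₁) ![1, 1] (d₂ * (d * (2 * p))) y₀ hy₀)
      (algebraMap (Localization.Away hh₁) _ (xU i : Localization.Away hh₁))) ∈ _
    rw [← ha, map_mul, map_mul, map_mul, hQX₀]
    exact Ideal.mul_mem_left _ _ (Ideal.mul_mem_left _ _ hJY)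
  -- ### move 3
  obtain ⟨𝒦₃, d₃, hd₃, hadm₃, hmove₃⟩ := d4_move3 hp hG M₂ W₂
    ({ affine := hW₂aff, m := m + 1, r := Fin.cons 0 r, B := ChartRing 𝒜P (![z, X₀] : Fin 2 → Localization.Away hh₁) ![1, 1] (d₂ * (d * (2 * p))) y₀ hy₀,
        𝒜 := chartNodeGrading r 𝒜P (![z, X₀] : Fin 2 → Localization.Away hh₁) ![1, 1] hf₂ (d₂ * (d * (2 * p))) y₀ hy₀,
        σ := sigmaChart 𝒜P (![z, X₀] : Fin 2 → Localization.Away hh₁) ![1, 1] (d₂ * (d * (2 * p))) y₀ hy₀ τP hσJ₂ hp.pos hσp₂ hσy₀, e := E₂, tame := htame₂, intertwine := hE₂ } : NodeData p M₂.act g₀ W₂)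
    ΦQ (conj ΦQ (sigmaChart 𝒜P (![z, X₀] : Fin 2 → Localization.Away hh₁) ![1, 1] (d₂ * (d * (2 * p))) y₀ hy₀ τP hσJ₂ hp.pos hσp₂ hσy₀)) (fun _ => rfl)
    t (algebraMap (MvPolynomial (Option (Option (Fin 4))) k) _ (X (some none))) (algebraMap (MvPolynomial (Option (Option (Fin 4))) k) _ (X (some (some 0))))
    (algebraMap (MvPolynomial (Option (Option (Fin 4))) k) _ (X (some (some 1)))) (algebraMap (MvPolynomial (Option (Option (Fin 4))) k) _ (X (some (some 2))))
    (algebraMap (MvPolynomial (Option (Option (Fin 4))) k) _ (X (some (some 3)))) (algebraMap (MvPolynomial (Option (Option (Fin 4))) k) _ (X none)) Vi V₀ _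
    rt rs rY rZ rX₁ rx₃ rw' rV₀ hVV rfix hgen hX₁u hZu (consIndexEquiv r ((1 : ℤ), 2 • θ)) (2 * d * d₂) hd' dY dw dδ dV hK1 hK1'
    (fun o : Option ι => Option.elim o W₂' U) (fun x => by
      rcases hcov x with h | h | ⟨i, h⟩
      · exact Or.inl h
      · exact Or.inr ⟨none, h⟩
      · exact Or.inr ⟨some i, h⟩)
    (fun o : Option ι => Option.elim o u₂ uU) (fun _ => 1) (fun _ => one_pos)
    (fun o => by rcases o with _ | i; exacts [hu₂val, huUval i]) (fun o => by rcases o with _ | i; exacts [hu₂U, huUU i]) 𝔄₂ hF₂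
  refine ⟨𝒦₃, d₃, hadm₃, fun M₃ hm₃ => ⟨⟨NodeAtlasData.ofNodeAtlas (p := p) (ρ := M₃.act) (g₀ := g₀) M₃.atlas⟩, ?_⟩⟩
  obtain ⟨π₃, hbl₃, -, hr₃, hcomm₃⟩ := hm₃
  haveI := hsep M₃
  obtain ⟨W₃, 𝔄₃, hF₃, hW₃aff, hle, hf₃, hσJ₃, hσp₃, y₃, hy₃v, hy₃, hσy₃, c₃, hc₃, E₃, W₃', u₃, htame₃, hE₃, hpin₃, hcov₃, hu₃v, hu₃U⟩ := hmove₃ M₃ π₃ hbl₃ hr₃ hcomm₃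
  -- ### move 4 = the kill, through the leaf
  have huU₃ : ∀ o : Option ι, ∀ v ∈ W₃.1, v ∈ π₃ ⁻¹ᵁ (Option.elim o W₂' U) → v ∈ M₃.V.basicOpen (π₃.appLE W₂.1 W₃.1 hle (Option.elim o u₂ uU)) := by
    intro o v hvW hvU
    rw [Scheme.basicOpen_appLE]
    refine ⟨hvW, ?_⟩
    rcases o with _ | i
    · exact hu₂U (π₃.base v) (hle hvW) hvU
    · exact huUU i (π₃.base v) (hle hvW) hvU
  exact d4_killsIn_one hp hG M₃ hQ (2 * d) (d₂ * (d * (2 * p))) (2 * d * d₂) (Nat.mul_pos two_pos hd) (Nat.mul_pos hd₂ (Nat.mul_pos hd (Nat.mul_pos two_pos hp.pos))) hd' hhQ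
    _ _ _ _ _ _ t V₀ NX rfl rfl rfl rfl rfl rfl _ (consIndexEquiv r ((1 : ℤ), 2 • θ)) (consIndexEquiv r ((0 : ℤ), -θ)) (consIndexEquiv r ((-1 : ℤ), 0))
    (conj ΦQ (sigmaChart 𝒜P (![z, X₀] : Fin 2 → Localization.Away hh₁) ![1, 1] (d₂ * (d * (2 * p))) y₀ hy₀ τP hσJ₂ hp.pos hσp₂ hσy₀))
    rt rs rY rZ rX₁ rx₃ rw' rN rfix rhQ hσp₃ hV₀u hNu ds dt dN
    (by rw [consIndexEquiv_pair r (1 : ℤ) (2 • θ), consIndexEquiv_pair r (-1 : ℤ) 0, consIndexEquiv_zero_nsmul, consIndexEquiv_zero_neg, Prod.mk_zero_zero, map_zero]; abel)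
    d₃ hd₃ W₃ hW₃aff hf₃ hσJ₃ y₃ hy₃v hy₃ hσy₃ c₃ hc₃ E₃ htame₃ hE₃
    (fun o : Option ι => π₃ ⁻¹ᵁ (Option.elim o W₂' U)) W₃' hcov₃ u₃ hu₃v hu₃U
    (fun o : Option ι => π₃.appLE W₂.1 W₃.1 hle (Option.elim o u₂ uU))
    (fun o : Option ι => (E₂.trans (zeroRingEquiv (chartNodeGrading r 𝒜P (![z, X₀] : Fin 2 → Localization.Away hh₁) ![1, 1] hf₂ (d₂ * (d * (2 * p))) y₀ hy₀) ΦQ)) (Option.elim o u₂ uU))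
    (fun o => by rcases o with _ | i; exacts [hu₂val, huUval i]) (fun o => hpin₃ _) huU₃ 𝔄₃ hF₃

end Summit.ResolutionOfSingularities.ResolutionOfSingularities.Theorems.WildQuotientResolution.S1.GameFrame.GModel

end
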